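import Mathlib
import Summits.Ventures.HodgeRepro.Tier4.Common.LocalTorusCompact
import Summits.Ventures.HodgeRepro.Tier4.Line4.LevelIntersection
import Summits.Ventures.HodgeRepro.Tier4.Line4.TorusProduct

/-!
# Tier4/Line4/LevelIntersectionGA — C-L4-LEVELINTER: `⋂_N K(p^N) = K^{(p)}` on `G(𝔸)`, the antitone laws along `p^n`

Blind re-derivation cell `pub-hodge-repro`, Tier 4 «prove the step» (README §9–§10), seat t4-L4-p1 (prover, LINE L4,
gen 4; plan-4 g5's (1) S15484 after the finding F-L4-PHASE-PPOWER).  Tree path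
`lean/Summits/Ventures/HodgeRepro/Tier4/Line4/LevelIntersectionGA.lean`.  Mathlib-level; no literature.

WHAT IS PROVED.  `mem_levelK_pow_forall_iff`: an element of `G(𝔸)` lies in the level group `K(p^N)` for EVERY `N` iff it
lies in the finite part, its component at every place `v` above `p` (`|p|_v < 1`) is `1`, and it is `v`-integral at every
finite place (`maximalCompactAt`).  So `⋂_N levelK W (p^N) = K^{(p)}`, the compact open group «`1` at `p`, integral away
from `p`» — NOT `{1}`: the level fibre of the (7b) witness along `lev n = p^{n+n₁}` shrinks to the `p`-stabiliser only
(the finding).  Also the antitone laws `levelK_pow_antitone` / `levelDoubleCoset_pow_antitone` along `p^n`.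

Nothing here says anything about the status of the Hodge conjecture for CM abelian varieties, which is NOT proved
(HC_CM is NOT proved by anyone in this repository).
-/

set_option autoImplicit false

noncomputable section

namespace Summit.Ventures.HodgeRepro.Tier4.Line4

open Summit.Ventures.HodgeRepro.Tier4.Common Summit.Ventures.HodgeRepro.Tier4.Line1 NumberField IsDedekindDomain

section Entries

variable (k : Type) [Field k] [NumberField k]

/-- the `v`-component of an adele is the `v`-component of its finite part (`adComponentFin` unfolded). -/
theorem adComponentFin_eq (v : HeightOneSpectrum (𝓞 k)) (x : Ad k) : adComponentFin k v x = finPart k x v := rfl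

/-- the `v`-component of an entry of the identity matrix -/
theorem adComponentFin_one_apply (v : HeightOneSpectrum (𝓞 k)) (i j : Fin 4) :
    adComponentFin k v ((1 : M4 k) i j) = (1 : Matrix (Fin 4) (Fin 4) (v.adicCompletion k)) i j := by
  rw [Matrix.one_apply, Matrix.one_apply]
  split_ifs <;> simp

/-- the `v`-component of an entry of the identity matrix is integral -/
theorem adComponentFin_one_apply_mem (v : HeightOneSpectrum (𝓞 k)) (i j : Fin 4) :
    adComponentFin k v ((1 : M4 k) i j) ∈ v.adicCompletionIntegers k := by
  rw [adComponentFin_one_apply, Matrix.one_apply]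
  split_ifs
  · exact Subring.one_mem _
  · exact Subring.zero_mem _

end Entries

section Intersection

variable {k : Type} [Field k] [NumberField k] (W : PlaneData k)

/-- **The congruence condition along all `p`-powers, entrywise**: for `A : M4 k`, `IsCongr (p^N) A` for every `N` iff the
archimedean part of `A − 1` vanishes, the `v`-components of `A` are those of `1` at the places above `p`, and `A` is
`v`-integral at every finite place. -/
theorem isCongr_pow_forall_iff {p : ℕ} (hp : p ≠ 0) (A : M4 k) :
    (∀ N : ℕ, IsCongr k (p ^ N) A) ↔
      (∀ i j, infPart k ((A - 1) i j) = 0) ∧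
        (∀ v : HeightOneSpectrum (𝓞 k), natSize k v p < 1 →
          ∀ i j, adComponentFin k v (A i j) = (1 : Matrix (Fin 4) (Fin 4) (v.adicCompletion k)) i j) ∧
        ∀ v : HeightOneSpectrum (𝓞 k), ∀ i j, adComponentFin k v (A i j) ∈ v.adicCompletionIntegers k := by
  constructor
  · intro h
    refine ⟨fun i j => (h 0 i j).1, fun v hv i j => ?_, fun v i j => ?_⟩
    · have hmod : ∀ N, finPart k ((A - 1) i j) ∈ modSet k (p ^ N) := fun N => (h N i j).2
      have h0 := ((mem_modSet_pow_forall_iff k hp _).1 hmod v).1 hv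
      rw [Matrix.sub_apply, map_sub] at h0
      have : adComponentFin k v (A i j) - adComponentFin k v ((1 : M4 k) i j) = 0 := by
        rw [adComponentFin_eq, adComponentFin_eq]
        exact h0
      rw [sub_eq_zero.1 this, adComponentFin_one_apply]
    · have hmod : ∀ N, finPart k ((A - 1) i j) ∈ modSet k (p ^ N) := fun N => (h N i j).2
      have h1 := ((mem_modSet_pow_forall_iff k hp _).1 hmod v).2
      have hA1 : adComponentFin k v ((A - 1) i j) ∈ v.adicCompletionIntegers k := by
        rw [HeightOneSpectrum.mem_adicCompletionIntegers, adComponentFin_eq]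
        exact h1
      have : adComponentFin k v (A i j) =
          adComponentFin k v ((A - 1) i j) + adComponentFin k v ((1 : M4 k) i j) := by
        rw [Matrix.sub_apply, map_sub, sub_add_cancel]
      rw [this]
      exact Subring.add_mem _ hA1 (adComponentFin_one_apply_mem k v i j)
  · rintro ⟨hinf, hp1, hint⟩ N i j
    refine ⟨hinf i j, ?_⟩
    refine (mem_modSet_pow_forall_iff k hp _).2 (fun v => ⟨fun hv => ?_, ?_⟩) N
    · rw [← adComponentFin_eq, Matrix.sub_apply, map_sub, hp1 v hv i j, adComponentFin_one_apply, sub_self]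
    · rw [← adComponentFin_eq, ← HeightOneSpectrum.mem_adicCompletionIntegers, Matrix.sub_apply, map_sub]
      exact Subring.sub_mem _ (hint v i j) (adComponentFin_one_apply_mem k v i j)

/-- **`⋂_N K(p^N) = K^{(p)}`**: `g ∈ levelK W (p^N)` for every `N` iff `g ∈ G(𝔸_f)`, `g_v = 1` at every place above `p`,
and `g ∈ K_v` at every finite place. -/
theorem mem_levelK_pow_forall_iff {p : ℕ} (hp : p ≠ 0) (g : GA W) :
    (∀ N : ℕ, g ∈ levelK W (p ^ N)) ↔
      g ∈ finitePart W ∧ (∀ v : HeightOneSpectrum (𝓞 k), natSize k v p < 1 → GA.finiteComponent W v g = 1) ∧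
        ∀ v : HeightOneSpectrum (𝓞 k), g ∈ maximalCompactAt W v := by
  constructor
  · intro h
    have hg : ∀ N, IsCongr k (p ^ N) (GA.mat W g) := fun N => ((mem_levelK W _ g).1 (h N)).1
    have hg' : ∀ N, IsCongr k (p ^ N) (GA.mat W g⁻¹) := fun N => ((mem_levelK W _ g).1 (h N)).2
    obtain ⟨-, hp1, hint⟩ := (isCongr_pow_forall_iff (k := k) hp _).1 hg
    obtain ⟨-, -, hint'⟩ := (isCongr_pow_forall_iff (k := k) hp _).1 hg'
    refine ⟨levelK_le_finitePart W (p ^ 0) (h 0), fun v hv => ?_, fun v => ?_⟩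
    · exact (finiteComponent_eq_one_iff W v g).2 (hp1 v hv)
    · rw [mem_maximalCompactAt]
      refine ⟨fun i j => ?_, fun i j => ?_⟩
      · rw [GA.finiteComponent_apply]
        exact hint v i j
      · rw [← map_inv, GA.finiteComponent_apply]
        exact hint' v i j
  · rintro ⟨hfin, hp1, hK⟩ N
    rw [mem_levelK]
    have hfin' : g⁻¹ ∈ finitePart W := (finitePart W).inv_mem hfin
    have hone : infM k (GA.mat W g) = 1 := infM_eq_one_of_mem_finitePart W hfin
    have hone' : infM k (GA.mat W g⁻¹) = 1 := infM_eq_one_of_mem_finitePart W hfin'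
    have hinfP : ∀ (M : M4 k), infM k M = 1 → ∀ i j, infPart k ((M - 1) i j) = 0 := by
      intro M hM i j
      rw [Matrix.sub_apply, map_sub, sub_eq_zero]
      exact (congrFun (congrFun hM i) j).trans (congrFun (congrFun (infM_one (k := k)) i) j).symm
    refine ⟨(isCongr_pow_forall_iff (k := k) hp _).2 ⟨hinfP _ hone, fun v hv i j => ?_, fun v i j => ?_⟩ N,
      (isCongr_pow_forall_iff (k := k) hp _).2 ⟨hinfP _ hone', fun v hv i j => ?_, fun v i j => ?_⟩ N⟩
    · exact (finiteComponent_eq_one_iff W v g).1 (hp1 v hv) i j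
    · rw [← GA.finiteComponent_apply]
      exact ((mem_maximalCompactAt W v g).1 (hK v)).1 i j
    · have h1 : GA.finiteComponent W v g⁻¹ = 1 := by rw [map_inv, hp1 v hv, inv_one]
      exact (finiteComponent_eq_one_iff W v g⁻¹).1 h1 i j
    · rw [← GA.finiteComponent_apply, map_inv]
      exact ((mem_maximalCompactAt W v g).1 (hK v)).2 i j

/-- **Antitone along `p`-powers**: `K(p^{n+1}) ≤ K(p^n)`. -/
theorem levelK_pow_antitone (p n : ℕ) : levelK W (p ^ (n + 1)) ≤ levelK W (p ^ n) := by
  intro g hg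
  rw [mem_levelK] at hg ⊢
  refine ⟨fun i j => ⟨(hg.1 i j).1, ?_⟩, fun i j => ⟨(hg.2 i j).1, ?_⟩⟩
  · exact modSet_antitone k (pow_dvd_pow p (Nat.le_succ n)) (hg.1 i j).2
  · exact modSet_antitone k (pow_dvd_pow p (Nat.le_succ n)) (hg.2 i j).2

/-- `K(p^m) ≤ K(p^n)` for `n ≤ m`. -/
theorem levelK_pow_antitone' (p : ℕ) {n m : ℕ} (h : n ≤ m) : levelK W (p ^ m) ≤ levelK W (p ^ n) := by
  intro g hg
  rw [mem_levelK] at hg ⊢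
  refine ⟨fun i j => ⟨(hg.1 i j).1, ?_⟩, fun i j => ⟨(hg.2 i j).1, ?_⟩⟩
  · exact modSet_antitone k (pow_dvd_pow p h) (hg.1 i j).2
  · exact modSet_antitone k (pow_dvd_pow p h) (hg.2 i j).2

end Intersection

end Summit.Ventures.HodgeRepro.Tier4.Line4

end
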